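import Literature.NumberTheory.Automorphic.CompletedCohomology
import HarnessLib

/-!
# Hecke operators between two levels `[L g L'] : H^i(X_{L'}, M) → H^i(X_L, M)` and the
# level-lowering factorisation (Hida's lemma, finiteness-free form)

Topic `NumberTheory/Automorphic`, namespace `Literature.NumberTheory.Automorphic.ArithmeticQuotient`;
a complement to `ArithmeticQuotientCohomology` (cohomology `H^i(X_L, M) = H^i(Γ, Fun(𝒢 ⧸ L, M))`
of the arithmetic quotient of level `L ≤ 𝒢`, Hecke operators `heckeFun k L g M = [L g L]`,
pull-back `pullbackHom` / `cohomologyPullback` along `L' ≤ L`).  Vocabulary and the generic half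
of Lemma 6.5 (3) / Lemma 6.10 of [KhareThorne2017] (there for homology and complexes), used in the
proof of Hida's control theorem (`hidaControl_dominantOrdinaryPoint`):

* `doubleCosetQuot₂ L L' g = L g L' / L' ⊆ 𝒢 ⧸ L'` and the **two-level Hecke operator**
  `heckeFun₂ k L L' g M = [L g L'] : Fun(𝒢 ⧸ L', M) → Fun(𝒢 ⧸ L, M)`,
  `(T f)(xL) = ∑_{hL' ⊆ L g L'} f(x h L')` (junk value `0` when `L g L' / L'` is infinite), the
  double coset operator `[U α U']` of [KhareThorne2017, §6.2, Lemma 6.5 (3)]; it is `Γ`-equivariant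
  (`heckeRepHom₂`) and induces `heckeOperator₂ … i : H^i(X_{L'}, M) ⟶ H^i(X_L, M)`;
  `heckeFun₂ k L L g M = heckeFun k L g M` (`heckeFun₂_self`, definitional).
* **Factorisation through the smaller level** (`L' ≤ L`).  Under the coset identity
  `L g L' = L' g L'` (hypothesis `hC₁`), `res ∘ [L g L'] = [L' g L']`
  (`pullbackHom_hom_heckeFun₂`, `heckeOperator₂_comp_cohomologyPullback`): the operator `[L' g L']`
  of level `L'` FACTORS through `H^i(X_L, M)` — [KhareThorne2017, Lemma 6.5 (3)].  Under the
  stabiliser identity `Stab_L(gL) = Stab_L(gL')` (hypothesis `hC₂`: `L g L'/L' → L g L/L` is a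
  bijection), `[L g L'] ∘ res = [L g L]` (`heckeFun₂_pullbackHom_hom`,
  `cohomologyPullback_comp_heckeOperator₂`).
* `bijOn_of_comp_eq` (**Hida's lemma, abstract form**): if `T ∘ res = U` and `res ∘ T = U'`, then
  `res` is a bijection between any pair of subspaces `V₀, W₀` exchanged by `res`, `T` on which `U`
  is injective and `U'` surjective (e.g. the ordinary parts of finite modules) — the mechanism of
  [KhareThorne2017, Lemma 6.10] ("the natural map `H(X_{U(b,c)})_ord → H(X_{U(b,b)})_ord` is an
  isomorphism"); also `ker res ≤ ker U`, `range U' ≤ range res` (`ker_le_ker_of_comp_eq`,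
  `range_le_range_of_comp_eq`).

The group-theoretic hypotheses `hC₁`, `hC₂` for the Iwahori levels of `GL₂` are verified in a
separate file.

## References

* C. Khare, J. A. Thorne, *Potential automorphy and the Leopoldt conjecture*, Amer. J. Math. 139
  (2017), §6.2, Lemma 6.5; §6.3, Lemma 6.10 (arXiv:1409.7007, held; read 2026-08-16).
  [KhareThorne2017]
* H. Hida, *p-adic ordinary Hecke algebras for GL(2)*, Ann. Inst. Fourier 44 (1994), §2 (held).
  [Hida1994AIF]
* G. Shimura, *Introduction to the arithmetic theory of automorphic functions* (1971), Ch. 3, §3.1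
  (double cosets `Γ α Γ'` between two commensurable groups). [ShimuraIATAF1971]
-/

noncomputable section

open CategoryTheory

universe u

namespace Literature.NumberTheory.Automorphic

namespace ArithmeticQuotient

variable (k : Type u) [CommRing k] {Γ 𝒢 : Type u} [Group Γ] [Group 𝒢]

/-! ### The double coset `L g L' / L'` and the operator `[L g L']` on functions -/

section TwoLevel

variable (L L' : Subgroup 𝒢) (g : 𝒢)

omit [Group Γ] in
variable {k} in
/-- The double coset `L g L'` viewed inside `𝒢 ⧸ L'`: the set `L g L' / L'` of left `L'`-cosets it
contains, i.e. the orbit of `gL'` under `L`. [cite: ShimuraIATAF1971, Ch. 3, §3.1] -/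
def doubleCosetQuot₂ : Set (𝒢 ⧸ L') :=
  MulAction.orbit L (g : 𝒢 ⧸ L')

omit [Group Γ] in
/-- For `L' = L` this is `doubleCosetQuot L g = L g L / L` (definitional). [folklore] -/
theorem doubleCosetQuot₂_self : doubleCosetQuot₂ L L g = doubleCosetQuot L g :=
  rfl

omit [Group Γ] in
variable {L L' g} in
/-- `L g L' / L'` is stable under left multiplication by `L`. [folklore] -/
theorem coe_smul_mem_doubleCosetQuot₂ {x : 𝒢 ⧸ L'} (hx : x ∈ doubleCosetQuot₂ L L' g) (l : L) :
    (l : 𝒢) • x ∈ doubleCosetQuot₂ L L' g := by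
  obtain ⟨m, rfl⟩ := hx
  refine ⟨l * m, ?_⟩
  show (l * m) • (g : 𝒢 ⧸ L') = (l : 𝒢) • m • (g : 𝒢 ⧸ L')
  rw [mul_smul]
  rfl

variable (M : Type u) [AddCommGroup M] [Module k M]

open scoped Classical in
omit [Group Γ] in
/-- The **two-level Hecke operator `[L g L'] : Fun(𝒢 ⧸ L', M) → Fun(𝒢 ⧸ L, M)`**:
`(T f)(xL) = ∑_{hL' ⊆ L g L'} f(x h L')` (the sum over `d ∈ L g L' / L'` of `f(x • d)`, independent of
the representative `x` of `xL` since `L` permutes `L g L' / L'`); junk value `0` when `L g L' / L'`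
is infinite.  For `L' = L` it is `heckeFun` (`heckeFun₂_self`).  This is the double coset operator
`[U α U']` between two levels of [cite: KhareThorne2017, §6.2, Lemma 6.5 (3)]
([cite: ShimuraIATAF1971, Ch. 3, §3.1]: `Γ α Γ'`). -/
def heckeFun₂ : ((𝒢 ⧸ L') → M) →ₗ[k] ((𝒢 ⧸ L) → M) where
  toFun f c := if h : (doubleCosetQuot₂ L L' g).Finite then ∑ d ∈ h.toFinset, f (c.out • d) else 0
  map_add' f f' := by
    ext c
    split_ifs <;> simp [Finset.sum_add_distrib]
  map_smul' r f := by
    ext c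
    split_ifs <;> simp [Finset.smul_sum]

open scoped Classical in
omit [Group Γ] in
/-- Unfolding lemma for `heckeFun₂`. [folklore] -/
theorem heckeFun₂_apply (f : (𝒢 ⧸ L') → M) (c : 𝒢 ⧸ L) :
    heckeFun₂ k L L' g M f c =
      if h : (doubleCosetQuot₂ L L' g).Finite then ∑ d ∈ h.toFinset, f (c.out • d) else 0 :=
  rfl

omit [Group Γ] in
/-- `[L g L] = T_g`: for `L' = L` the two-level operator is the Hecke operator `heckeFun`
(definitional). [folklore] -/
theorem heckeFun₂_self : heckeFun₂ k L L g M = heckeFun k L g M :=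
  rfl

omit [Group Γ] in
variable {k L L' g M} in
/-- Re-indexing a sum over `L g L' / L'` by left multiplication with `l ∈ L`. [folklore] -/
theorem sum_doubleCosetQuot₂_coe_smul (h : (doubleCosetQuot₂ L L' g).Finite) (l : L)
    (F : 𝒢 ⧸ L' → M) : ∑ d ∈ h.toFinset, F ((l : 𝒢) • d) = ∑ d ∈ h.toFinset, F d := by
  refine Finset.sum_nbij' (fun d => (l : 𝒢) • d) (fun d => (l : 𝒢)⁻¹ • d) ?_ ?_ ?_ ?_
    fun _ _ => rfl
  · intro d hd
    rw [Set.Finite.mem_toFinset] at hd ⊢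
    exact coe_smul_mem_doubleCosetQuot₂ hd l
  · intro d hd
    rw [Set.Finite.mem_toFinset] at hd ⊢
    simpa using coe_smul_mem_doubleCosetQuot₂ hd l⁻¹
  · intro d _
    simp
  · intro d _
    simp

open scoped Classical in
omit [Group Γ] in
/-- The value of `[L g L'] f` at `xL` computed with the representative `x`:
`([L g L'] f)(xL) = ∑_{d ∈ LgL'/L'} f(x • d)`. [folklore] -/
theorem heckeFun₂_apply_coe (f : (𝒢 ⧸ L') → M) (x : 𝒢) (h : (doubleCosetQuot₂ L L' g).Finite) :
    heckeFun₂ k L L' g M f (x : 𝒢 ⧸ L) = ∑ d ∈ h.toFinset, f (x • d) := by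
  rw [heckeFun₂_apply, dif_pos h]
  obtain ⟨l, hl⟩ := QuotientGroup.mk_out_eq_mul L x
  rw [hl]
  simp_rw [mul_smul]
  exact sum_doubleCosetQuot₂_coe_smul h l fun d => f (x • d)

open scoped Classical in
omit [Group Γ] in
/-- The documented junk value: `[L g L'] = 0` when `L g L' / L'` is infinite. [folklore] -/
theorem heckeFun₂_eq_zero_of_infinite (h : ¬ (doubleCosetQuot₂ L L' g).Finite) :
    heckeFun₂ k L L' g M = 0 := by
  refine LinearMap.ext fun f => funext fun c => ?_
  rw [heckeFun₂_apply, dif_neg h, LinearMap.zero_apply, Pi.zero_apply]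

variable (ι : Γ →* 𝒢)

/-- `[L g L']` commutes with the left-translation actions of `Γ` (left and right multiplication
commute). [cite: ShimuraIATAF1971, Ch. 3, §3.1] -/
theorem heckeFun₂_coeffRepresentation (γ : Γ) (f : (𝒢 ⧸ L') → M) :
    heckeFun₂ k L L' g M (coeffRepresentation k ι L' M γ f) =
      coeffRepresentation k ι L M γ (heckeFun₂ k L L' g M f) := by
  ext c
  simp only [heckeFun₂_apply, coeffRepresentation_apply]
  split_ifs with h
  · have hc : (ι γ)⁻¹ • c = (((ι γ)⁻¹ * c.out : 𝒢) : 𝒢 ⧸ L) := by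
      conv_lhs => rw [← QuotientGroup.out_eq' c]
      rfl
    obtain ⟨l, hl⟩ := QuotientGroup.mk_out_eq_mul L ((ι γ)⁻¹ * c.out)
    rw [hc, hl]
    simp_rw [mul_smul]
    exact (sum_doubleCosetQuot₂_coe_smul h l fun d => f ((ι γ)⁻¹ • c.out • d)).symm
  · rfl

/-- `[L g L']` as a morphism `Fun(𝒢 ⧸ L', M) ⟶ Fun(𝒢 ⧸ L, M)` of `Γ`-representations. [folklore] -/
def heckeRepHom₂ : coeffRep k ι L' M ⟶ coeffRep k ι L M :=
  Rep.ofHom ⟨heckeFun₂ k L L' g M, fun γ =>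
    LinearMap.ext fun f => heckeFun₂_coeffRepresentation k L L' g M ι γ f⟩

/-- Unfolding lemma for `heckeRepHom₂`. [folklore] -/
@[simp]
theorem heckeRepHom₂_hom_apply (f : (𝒢 ⧸ L') → M) :
    (heckeRepHom₂ k L L' g M ι).hom f = heckeFun₂ k L L' g M f :=
  rfl

/-- **The two-level Hecke operator `[L g L'] : H^i(X_{L'}, M) ⟶ H^i(X_L, M)`** (functoriality of
group cohomology applied to `heckeRepHom₂`). [cite: KhareThorne2017, §6.2, Lemma 6.5 (3)] -/
abbrev heckeOperator₂ (i : ℕ) : cohomology k ι L' M i ⟶ cohomology k ι L M i :=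
  groupCohomology.map (MonoidHom.id Γ) (heckeRepHom₂ k L L' g M ι) i

/-- For `L' = L`, `heckeOperator₂` is the Hecke operator `heckeOperator` (definitional). [folklore] -/
theorem heckeOperator₂_self (i : ℕ) : heckeOperator₂ k L L g M ι i = heckeOperator k L g M ι i :=
  rfl

end TwoLevel

/-! ### Factorisation through the smaller level -/

section Factorisation

variable {L L' : Subgroup 𝒢} (g : 𝒢) (M : Type u) [AddCommGroup M] [Module k M] (ι : Γ →* 𝒢)

omit [Group Γ] in
variable {k g} in
/-- **`L g L' = L' g L'`** (as subsets of `𝒢 ⧸ L'`) as soon as every `l g L'`, `l ∈ L`, is of the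
form `l' g L'` with `l' ∈ L'` — hypothesis `hC₁`, i.e. `L ⊆ L' · (g L' g⁻¹)`. [folklore] -/
theorem doubleCosetQuot₂_eq_doubleCosetQuot (h : L' ≤ L)
    (hC₁ : ∀ l ∈ L, ∃ l' ∈ L', (((l * g : 𝒢)) : 𝒢 ⧸ L') = ((l' * g : 𝒢) : 𝒢 ⧸ L')) :
    doubleCosetQuot₂ L L' g = doubleCosetQuot L' g := by
  ext d
  constructor
  · rintro ⟨l, rfl⟩
    obtain ⟨l', hl', e⟩ := hC₁ l l.2
    refine ⟨⟨l', hl'⟩, ?_⟩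
    change ((l' : 𝒢) • (g : 𝒢 ⧸ L')) = ((l : 𝒢) • (g : 𝒢 ⧸ L'))
    rw [MulAction.Quotient.smul_coe, MulAction.Quotient.smul_coe, smul_eq_mul, smul_eq_mul, e]
  · rintro ⟨l', rfl⟩
    exact ⟨⟨l', h l'.2⟩, rfl⟩

/-- **`res ∘ [L g L'] = [L' g L']` on functions** (`L' ≤ L`, `L g L' = L' g L'`): the level-`L'`
operator `[L' g L']` factors through `Fun(𝒢 ⧸ L, M)`. [cite: KhareThorne2017, §6.2, Lemma 6.5 (3)] -/
theorem pullbackHom_hom_heckeFun₂ (h : L' ≤ L)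
    (hC₁ : ∀ l ∈ L, ∃ l' ∈ L', (((l * g : 𝒢)) : 𝒢 ⧸ L') = ((l' * g : 𝒢) : 𝒢 ⧸ L'))
    (f : (𝒢 ⧸ L') → M) :
    (pullbackHom k ι M h).hom (heckeFun₂ k L L' g M f) = heckeFun k L' g M f := by
  classical
  have hS := doubleCosetQuot₂_eq_doubleCosetQuot h hC₁
  funext c
  induction c using QuotientGroup.induction_on with
  | H x =>
    rw [pullbackHom_apply]
    change heckeFun₂ k L L' g M f (x : 𝒢 ⧸ L) = _
    by_cases hfin : (doubleCosetQuot₂ L L' g).Finite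
    · have hfin' : (doubleCosetQuot L' g).Finite := by rwa [← hS]
      rw [heckeFun₂_apply_coe k L L' g M f x hfin, heckeFun_apply_coe k L' M g f x hfin']
      exact Finset.sum_congr (Finset.ext fun d => by
        rw [Set.Finite.mem_toFinset, Set.Finite.mem_toFinset, hS]) fun _ _ => rfl
    · have hfin' : ¬ (doubleCosetQuot L' g).Finite := by rwa [← hS]
      rw [heckeFun₂_apply, dif_neg hfin, heckeFun_apply, dif_neg hfin']

/-- `[L g L'] ≫ res = [L' g L']` as morphisms of `Γ`-representations. [folklore] -/
theorem heckeRepHom₂_comp_pullbackHom (h : L' ≤ L)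
    (hC₁ : ∀ l ∈ L, ∃ l' ∈ L', (((l * g : 𝒢)) : 𝒢 ⧸ L') = ((l' * g : 𝒢) : 𝒢 ⧸ L')) :
    heckeRepHom₂ k L L' g M ι ≫ pullbackHom k ι M h = heckeRepHom k L' g M ι :=
  Rep.hom_ext (Representation.IntertwiningMap.ext
    (LinearMap.ext fun f => pullbackHom_hom_heckeFun₂ k g M ι h hC₁ f))

/-- **`[L g L'] ≫ res = T_g` on cohomology: the Hecke operator `[L' g L']` on `H^i(X_{L'}, M)`
factors as `H^i(X_{L'}, M) → H^i(X_L, M) → H^i(X_{L'}, M)`**, the two-level operator followed by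
the pull-back (`L' ≤ L`, `L g L' = L' g L'`). [cite: KhareThorne2017, §6.2, Lemma 6.5 (3)] -/
theorem heckeOperator₂_comp_cohomologyPullback (h : L' ≤ L)
    (hC₁ : ∀ l ∈ L, ∃ l' ∈ L', (((l * g : 𝒢)) : 𝒢 ⧸ L') = ((l' * g : 𝒢) : 𝒢 ⧸ L')) (i : ℕ) :
    heckeOperator₂ k L L' g M ι i ≫ cohomologyPullback k ι M h i = heckeOperator k L' g M ι i := by
  rw [heckeOperator₂, cohomologyPullback, ← groupCohomology.map_id_comp,
    heckeRepHom₂_comp_pullbackHom k g M ι h hC₁]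

omit [Group Γ] in
variable {k g M} in
/-- The projection `𝒢 ⧸ L' → 𝒢 ⧸ L` maps `L g L' / L'` onto `L g L / L`. [folklore] -/
theorem surjOn_quotientMapOfLE_doubleCosetQuot₂ (h : L' ≤ L) :
    Set.SurjOn (Subgroup.quotientMapOfLE h) (doubleCosetQuot₂ L L' g) (doubleCosetQuot L g) := by
  rintro _ ⟨l, rfl⟩
  refine ⟨l • (g : 𝒢 ⧸ L'), ⟨l, rfl⟩, ?_⟩
  show Subgroup.quotientMapOfLE h ((l : 𝒢) • (g : 𝒢 ⧸ L')) = (l : 𝒢) • (g : 𝒢 ⧸ L)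
  rw [quotientMapOfLE_smul]
  rfl

omit [Group Γ] in
variable {k g M} in
/-- The projection `𝒢 ⧸ L' → 𝒢 ⧸ L` maps `L g L' / L'` into `L g L / L`. [folklore] -/
theorem mapsTo_quotientMapOfLE_doubleCosetQuot₂ (h : L' ≤ L) :
    Set.MapsTo (Subgroup.quotientMapOfLE h) (doubleCosetQuot₂ L L' g) (doubleCosetQuot L g) := by
  rintro _ ⟨l, rfl⟩
  refine ⟨l, ?_⟩
  show (l : 𝒢) • (g : 𝒢 ⧸ L) = Subgroup.quotientMapOfLE h ((l : 𝒢) • (g : 𝒢 ⧸ L'))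
  rw [quotientMapOfLE_smul]
  rfl

omit [Group Γ] in
variable {k g M} in
/-- Under the stabiliser hypothesis `hC₂` (`l g L = g L ⇒ l g L' = g L'` for `l ∈ L`, i.e.
`L ∩ g L g⁻¹ = L ∩ g L' g⁻¹`) the projection `L g L' / L' → L g L / L` is injective. [folklore] -/
theorem injOn_quotientMapOfLE_doubleCosetQuot₂ (h : L' ≤ L)
    (hC₂ : ∀ l ∈ L, (((l * g : 𝒢)) : 𝒢 ⧸ L) = (g : 𝒢 ⧸ L) → (((l * g : 𝒢)) : 𝒢 ⧸ L') = (g : 𝒢 ⧸ L')) :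
    Set.InjOn (Subgroup.quotientMapOfLE h) (doubleCosetQuot₂ L L' g) := by
  rintro _ ⟨l₁, rfl⟩ _ ⟨l₂, rfl⟩ he
  change Subgroup.quotientMapOfLE h ((l₁ : 𝒢) • (g : 𝒢 ⧸ L')) =
    Subgroup.quotientMapOfLE h ((l₂ : 𝒢) • (g : 𝒢 ⧸ L')) at he
  rw [quotientMapOfLE_smul, quotientMapOfLE_smul] at he
  change ((l₁ : 𝒢) • (g : 𝒢 ⧸ L)) = ((l₂ : 𝒢) • (g : 𝒢 ⧸ L)) at he
  change ((l₁ : 𝒢) • (g : 𝒢 ⧸ L')) = ((l₂ : 𝒢) • (g : 𝒢 ⧸ L'))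
  rw [MulAction.Quotient.smul_coe, MulAction.Quotient.smul_coe, smul_eq_mul, smul_eq_mul,
    QuotientGroup.eq] at he ⊢
  have h1 : ((((l₂ : 𝒢)⁻¹ * l₁) * g : 𝒢) : 𝒢 ⧸ L) = (g : 𝒢 ⧸ L) := by
    rw [QuotientGroup.eq]
    rw [show (((l₂ : 𝒢)⁻¹ * l₁) * g)⁻¹ * g = ((l₁ : 𝒢) * g)⁻¹ * ((l₂ : 𝒢) * g) by group]
    exact he
  have h2 := hC₂ _ (mul_mem (inv_mem l₂.2) l₁.2) h1
  rw [QuotientGroup.eq] at h2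
  rwa [show (((l₂ : 𝒢)⁻¹ * l₁) * g)⁻¹ * g = ((l₁ : 𝒢) * g)⁻¹ * ((l₂ : 𝒢) * g) by group] at h2

/-- **`[L g L'] ∘ res = [L g L]` on functions** (`L' ≤ L`, hypothesis `hC₂`): the sum over
`L g L' / L'` of `F(x h L)` is the sum over its bijective image `L g L / L`. [folklore] -/
theorem heckeFun₂_pullbackHom_hom (h : L' ≤ L)
    (hC₂ : ∀ l ∈ L, (((l * g : 𝒢)) : 𝒢 ⧸ L) = (g : 𝒢 ⧸ L) → (((l * g : 𝒢)) : 𝒢 ⧸ L') = (g : 𝒢 ⧸ L'))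
    (F : (𝒢 ⧸ L) → M) :
    heckeFun₂ k L L' g M ((pullbackHom k ι M h).hom F) = heckeFun k L g M F := by
  classical
  have hmap := mapsTo_quotientMapOfLE_doubleCosetQuot₂ (g := g) h
  have hinj := injOn_quotientMapOfLE_doubleCosetQuot₂ h hC₂
  have hsurj := surjOn_quotientMapOfLE_doubleCosetQuot₂ (g := g) h
  funext c
  induction c using QuotientGroup.induction_on with
  | H x =>
    by_cases hfin : (doubleCosetQuot₂ L L' g).Finite
    · have hfin' : (doubleCosetQuot L g).Finite := (hfin.image _).subset hsurj
      rw [heckeFun₂_apply_coe k L L' g M _ x hfin, heckeFun_apply_coe k L M g F x hfin']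
      refine Finset.sum_nbij (Subgroup.quotientMapOfLE h) (fun d hd => ?_) ?_ ?_
        (fun d _ => by rw [pullbackHom_apply, quotientMapOfLE_smul])
      · rw [Set.Finite.mem_toFinset] at hd ⊢
        exact hmap hd
      · simpa only [Set.Finite.coe_toFinset] using hinj
      · simpa only [Set.Finite.coe_toFinset] using hsurj
    · have hfin' : ¬ (doubleCosetQuot L g).Finite := fun hf =>
        hfin ((hf.subset hmap.image_subset).of_finite_image hinj)
      rw [heckeFun₂_apply, dif_neg hfin, heckeFun_apply, dif_neg hfin']

/-- `res ≫ [L g L'] = T_g` as morphisms of `Γ`-representations. [folklore] -/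
theorem pullbackHom_comp_heckeRepHom₂ (h : L' ≤ L)
    (hC₂ : ∀ l ∈ L, (((l * g : 𝒢)) : 𝒢 ⧸ L) = (g : 𝒢 ⧸ L) → (((l * g : 𝒢)) : 𝒢 ⧸ L') = (g : 𝒢 ⧸ L')) :
    pullbackHom k ι M h ≫ heckeRepHom₂ k L L' g M ι = heckeRepHom k L g M ι :=
  Rep.hom_ext (Representation.IntertwiningMap.ext
    (LinearMap.ext fun F => heckeFun₂_pullbackHom_hom k g M ι h hC₂ F))

/-- **`res ≫ [L g L'] = T_g` on cohomology**: the Hecke operator `[L g L]` on `H^i(X_L, M)` factors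
as `H^i(X_L, M) → H^i(X_{L'}, M) → H^i(X_L, M)`, the pull-back followed by the two-level operator
(`L' ≤ L`, hypothesis `hC₂`). [cite: KhareThorne2017, §6.3, Lemma 6.10 (proof)] -/
theorem cohomologyPullback_comp_heckeOperator₂ (h : L' ≤ L)
    (hC₂ : ∀ l ∈ L, (((l * g : 𝒢)) : 𝒢 ⧸ L) = (g : 𝒢 ⧸ L) → (((l * g : 𝒢)) : 𝒢 ⧸ L') = (g : 𝒢 ⧸ L'))
    (i : ℕ) :
    cohomologyPullback k ι M h i ≫ heckeOperator₂ k L L' g M ι i = heckeOperator k L g M ι i := by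
  rw [heckeOperator₂, cohomologyPullback, ← groupCohomology.map_id_comp,
    pullbackHom_comp_heckeRepHom₂ k g M ι h hC₂]

end Factorisation

end ArithmeticQuotient

/-! ### Hida's lemma, abstract form -/

section HidaLemma

variable {R : Type*} [Semiring R] {V W : Type*} [AddCommMonoid V] [AddCommMonoid W] [Module R V]
  [Module R W]

/-- If `T ∘ res = U` then `ker res ≤ ker U`. [folklore] -/
theorem ker_le_ker_of_comp_eq {res : V →ₗ[R] W} {T : W →ₗ[R] V} {U : V →ₗ[R] V}
    (h : T ∘ₗ res = U) : LinearMap.ker res ≤ LinearMap.ker U :=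
  h ▸ LinearMap.ker_le_ker_comp res T

/-- If `res ∘ T = U'` then `range U' ≤ range res`. [folklore] -/
theorem range_le_range_of_comp_eq {res : V →ₗ[R] W} {T : W →ₗ[R] V} {U' : W →ₗ[R] W}
    (h : res ∘ₗ T = U') : LinearMap.range U' ≤ LinearMap.range res :=
  h ▸ LinearMap.range_comp_le_range T res

/-- If `T ∘ res = U` and `res ∘ T = U'` then `res` intertwines `U` and `U'`. [folklore] -/
theorem comp_eq_comp_of_comp_eq {res : V →ₗ[R] W} {T : W →ₗ[R] V} {U : V →ₗ[R] V} {U' : W →ₗ[R] W}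
    (h₁ : T ∘ₗ res = U) (h₂ : res ∘ₗ T = U') : res ∘ₗ U = U' ∘ₗ res := by
  rw [← h₁, ← h₂, LinearMap.comp_assoc]

/-- **Hida's lemma (abstract form).**  Let `res : V → W`, `T : W → V` with `T ∘ res = U` and
`res ∘ T = U'`, and let `V₀ ⊆ V`, `W₀ ⊆ W` be exchanged by `res` and `T`.  If `U` is injective on
`V₀` and `U'` maps `W₀` onto itself (e.g. `V₀, W₀` the ordinary parts of finite Hecke modules, on
which `U, U'` are bijective), then `res : V₀ → W₀` is a bijection — the mechanism behind "the
natural map `H(X_{U(b,c)})_ord → H(X_{U(b,b)})_ord` is an isomorphism".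
[cite: KhareThorne2017, §6.3, Lemma 6.10] -/
theorem bijOn_of_comp_eq {res : V →ₗ[R] W} {T : W →ₗ[R] V} {U : V →ₗ[R] V} {U' : W →ₗ[R] W}
    (h₁ : T ∘ₗ res = U) (h₂ : res ∘ₗ T = U') {V₀ : Set V} {W₀ : Set W}
    (hres : Set.MapsTo res V₀ W₀) (hT : Set.MapsTo T W₀ V₀) (hU : Set.InjOn U V₀)
    (hU' : Set.SurjOn U' W₀ W₀) : Set.BijOn res V₀ W₀ := by
  refine ⟨hres, fun v₁ hv₁ v₂ hv₂ he => hU hv₁ hv₂ ?_, fun w hw => ?_⟩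
  · rw [← h₁, LinearMap.comp_apply, LinearMap.comp_apply, he]
  · obtain ⟨w₁, hw₁, rfl⟩ := hU' hw
    exact ⟨T w₁, hT hw₁, by rw [← h₂, LinearMap.comp_apply]⟩

end HidaLemma

end Literature.NumberTheory.Automorphic
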